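import Mathlib.Data.Real.Basic
import Mathlib.Tactic.Linarith
import Mathlib.Tactic.Ring
import Mathlib.Tactic.Positivity
import HarnessLib

/-!
# STAR½ on apex-forests — the algebraic core of the bridge step (Theorem B½-forest / C½ of prim-nh-lead-4575 gen 120)

Support file for the Sahi programme (`--supports stmt-CriticalPhenomena-4575`, lead prim-nh-lead-4575 gen 120).  No definitions, no named
facts, no sorries; standard axioms; pure real arithmetic.  Memo `run/shared/lean/prim/prim-sahi/FROM-prim-nh-lead-4575-g120-STAR-HALF.md` §5.

STAR½ (conjecture for all graphs; THEOREM on apex-forests and, by exact tensor-Bernstein certificates, on all graphs with ≤ 6 vertices):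
for the root-connection events `A = {s↔a}`, `B = {s↔b}`, `C = {s↔c}` of a finite weighted graph,
`3·P(ABC) + 3·P(A)P(B)P(C) ≥ 2·(P(A)P(BC) + P(B)P(AC) + P(C)P(AB))`, i.e. Sahi's cubic `E₃` is at least half the Harris gap
`P(ABC) − P(A)P(B)P(C)`; the constant is sharp (`a = b = c`).  Writing `F := (3/2)m_abc − Σ m_a m_bc + (3/2)m_a m_b m_c`, the proof on apex-forests is
the bridge/chord induction of prim-sahi-p2's Theorem C (`…IncStarBridgeConcavityCore`) with `F` in place of `E₃` and a CHOSEN bridge.  Along a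
bridge `e` of the environment separating target `a` (side `L`) from `b, c` (side `R`), with p2's side statistics (`α, γ, σ, τ, K` on `L`;
`σ′, d_b, d_c, d_bc, ξ_b, ξ_c, y_b, y_c, m_b, m_c` on `R`) one has `F″(t) = −2V½(t)`, `V½` non-increasing, `V½(1) = σ·W½` with
  `W½ = ασ′(ξ_b+ξ_c+d_bc) + 2(γ+K)d_bd_c + α(d_by_c + d_cy_b) − (3/2)τσ d_bd_c − (9/2)ασ′σ d_bd_c − (3/2)ασ′(m_bd_c + m_cd_b)`
  `    = α·RS + d_bd_c·Λ₀`,  `RS := σ′(ξ_b+ξ_c+d_bc) + d_by_c + d_cy_b − (3/2)σ′(m_bd_c+m_cd_b) − 3σ′d_bd_c`,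
  `Λ₀ := 3ασ′ + 2(γ+K) − (3/2)τσ − (9/2)ασ′σ`.
THIS FILE kernel-checks the real-arithmetic skeleton: `Λ₀ ≥ 0` from Harris on `L` (H2: `τσ ≤ γ+K`, H4: `σ(α+γ) ≤ γ`); `W½ ≥ 0` given the
R-SIDE LEMMA `RS ≥ 0`; the chord inequality for `F`; and the algebraic steps of the R-side lemma for forest sides — the two-branch and `b = v`
case estimates from `Cov ≤ 0` (Harris) and the BRANCH LEMMA `H + Cov ≥ 0`, and the recursion step proving the branch lemma on port-trees.  The
probabilistic identifications (slopes, branch formulas) are verified in exact arithmetic on random instances (lab-gen120/blob/*verify*.py) but are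
NOT formalised here.

* `bridgeConcavityHalf_bracket` — `0 ≤ Λ₀`;
* `bridgeConcavityHalf_core` — `0 ≤ W½` given `0 ≤ RS`;
* `bridgeConcavityHalf_chord` — `(1−t)F(0) + tF(1) ≤ F(t)` from the product-form slopes, given `0 ≤ RS`;
* `rsideHalf_twoBranch`, `rsideHalf_targetAtPort` — the case estimates of the R-side lemma;
* `branchLemma_step` — the port-tree recursion step of the branch lemma.
-/

namespace Summit.CriticalPhenomena.PercolationContinuityZ3.Theorems

namespace IncStar

/-- The `L`-side bracket of the STAR½ bridge step: from Harris on the one-target side (`τσ ≤ γ + K`, `σ(α+γ) ≤ γ`), `K ≥ 0`,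
`0 ≤ σ′ ≤ 1` and `α, γ ≥ 0`:  `0 ≤ Λ₀ = 3ασ′ + 2(γ+K) − (3/2)τσ − (9/2)ασ′σ`.  (If `σ ≤ 2/3` both parts are ≥ 0; otherwise
`3ασ′(1 − (3/2)σ) ≥ 3α(1 − (3/2)σ)` and `(α+γ)·(γ/2 + 3α − (9/2)ασ) ≥ 3α² − αγ + γ²/2 ≥ 0`.) [this work] -/
theorem bridgeConcavityHalf_bracket (α γ σ τ K σ' : ℝ) (hα : 0 ≤ α) (hγ : 0 ≤ γ) (hK : 0 ≤ K)
    (hσ'0 : 0 ≤ σ') (hσ'1 : σ' ≤ 1) (H2 : τ * σ ≤ γ + K) (H4 : σ * (α + γ) ≤ γ) :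
    0 ≤ 3 * α * σ' + 2 * (γ + K) - (3 / 2) * τ * σ - (9 / 2) * α * σ' * σ := by
  -- `2(γ+K) − (3/2)τσ ≥ (γ+K)/2 ≥ γ/2`
  have hL : γ / 2 ≤ 2 * (γ + K) - (3 / 2) * τ * σ := by nlinarith [H2, hK, hγ]
  by_cases h3 : 3 * σ ≤ 2
  · have : 0 ≤ 3 * α * σ' * (1 - (3 / 2) * σ) := mul_nonneg (by positivity) (by linarith)
    nlinarith [this, hL]
  · push Not at h3
    -- `3ασ′(1 − (3/2)σ) ≥ 3α(1 − (3/2)σ)` since the bracket is nonpositive and `σ′ ≤ 1`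
    have hstep : 3 * α * (1 - (3 / 2) * σ) ≤ 3 * α * σ' * (1 - (3 / 2) * σ) := by
      have h1 : 3 * α * σ' * (1 - (3 / 2) * σ) - 3 * α * (1 - (3 / 2) * σ)
          = 3 * α * (1 - σ') * ((3 / 2) * σ - 1) := by ring
      have h2 : 0 ≤ 3 * α * (1 - σ') * ((3 / 2) * σ - 1) :=
        mul_nonneg (mul_nonneg (by positivity) (by linarith)) (by linarith)
      linarith
    -- `γ/2 + 3α − (9/2)ασ ≥ 0` from `σ(α+γ) ≤ γ`
    have hkey : 0 ≤ γ / 2 + 3 * α - (9 / 2) * α * σ := by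
      by_cases hΩ : α + γ = 0
      · have hα0 : α = 0 := by linarith
        have hγ0 : γ = 0 := by linarith
        rw [hα0, hγ0]; simp
      · have hΩpos : 0 < α + γ := lt_of_le_of_ne (by linarith) (Ne.symm hΩ)
        have hprod : 0 ≤ (α + γ) * (γ / 2 + 3 * α - (9 / 2) * α * σ) := by
          have h1 : (α + γ) * (γ / 2 + 3 * α - (9 / 2) * α * σ)
              = (α + γ) * (γ / 2 + 3 * α) - (9 / 2) * α * (σ * (α + γ)) := by ring
          have h2 : (9 / 2) * α * (σ * (α + γ)) ≤ (9 / 2) * α * γ :=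
            mul_le_mul_of_nonneg_left H4 (by positivity)
          have h3' : 0 ≤ 3 * α ^ 2 - α * γ + γ ^ 2 / 2 := by
            nlinarith [sq_nonneg (α - γ / 6), sq_nonneg γ]
          nlinarith [h1, h2, h3']
        by_contra hneg
        push Not at hneg
        have : (α + γ) * (γ / 2 + 3 * α - (9 / 2) * α * σ) < 0 := mul_neg_of_pos_of_neg hΩpos hneg
        linarith
    nlinarith [hL, hstep, hkey]

/-- **STAR½ bridge step, algebraic core.**  With the notation of the module docstring: `W½ = α·RS + d_bd_c·Λ₀` (checked by `ring`),
so the `L`-side Harris facts (H2), (H4) and the `R`-side lemma `0 ≤ RS` give `0 ≤ W½`, i.e. `F″(1) ≤ 0` along the bridge. [this work] -/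
theorem bridgeConcavityHalf_core (α γ σ τ K σ' db dc dbc ξb ξc yb yc mb mc : ℝ)
    (hα : 0 ≤ α) (hγ : 0 ≤ γ) (hK : 0 ≤ K) (hσ'0 : 0 ≤ σ') (hσ'1 : σ' ≤ 1) (hdb : 0 ≤ db) (hdc : 0 ≤ dc)
    (H2 : τ * σ ≤ γ + K) (H4 : σ * (α + γ) ≤ γ)
    (hRS : 0 ≤ σ' * (ξb + ξc + dbc) + db * yc + dc * yb - (3 / 2) * σ' * (mb * dc + mc * db) - 3 * σ' * db * dc) :
    0 ≤ α * σ' * (ξb + ξc + dbc) + 2 * (γ + K) * db * dc + α * (db * yc + dc * yb)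
        - (3 / 2) * τ * σ * db * dc - (9 / 2) * α * σ' * σ * db * dc - (3 / 2) * α * σ' * (mb * dc + mc * db) := by
  have hbr := bridgeConcavityHalf_bracket α γ σ τ K σ' hα hγ hK hσ'0 hσ'1 H2 H4
  have hid : α * σ' * (ξb + ξc + dbc) + 2 * (γ + K) * db * dc + α * (db * yc + dc * yb)
        - (3 / 2) * τ * σ * db * dc - (9 / 2) * α * σ' * σ * db * dc - (3 / 2) * α * σ' * (mb * dc + mc * db)
      = α * (σ' * (ξb + ξc + dbc) + db * yc + dc * yb - (3 / 2) * σ' * (mb * dc + mc * db) - 3 * σ' * db * dc)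
        + (db * dc) * (3 * α * σ' + 2 * (γ + K) - (3 / 2) * τ * σ - (9 / 2) * α * σ' * σ) := by ring
  rw [hid]
  exact add_nonneg (mul_nonneg hα hRS) (mul_nonneg (mul_nonneg hdb hdc) hbr)

/-- **Chord inequality for `F = (3/2)m_abc − Σ m_a m_bc + (3/2)m_a m_b m_c` along a bridge, from the product-form slopes.**  Moments affine in
`t = w_e` with `t = 0` values `τ, m_b, m_c, τm_b, τm_c, m_bc, τm_bc` and slopes `δ_a = ασ′`, `δ_b = d_bσ`, `δ_c = d_cσ`,
`δ_ab = (γ+K)d_b + αy_b`, `δ_ac = (γ+K)d_c + αy_c`, `δ_bc = σ(ξ_b+ξ_c+d_bc)` (`δ_abc` arbitrary).  Key identity (by `ring`):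
`F(t) − [(1−t)F(0) + tF(1)] = t(1−t)·(σ·W½ + (3/2)δ_aδ_bδ_c(2−t))`.  Hence, granted (H2), (H4), `σ ≥ 0` and the R-side lemma `0 ≤ RS`,
`F` lies above its chords on `[0,1]`. [this work] -/
theorem bridgeConcavityHalf_chord (τ mb mc mbc δabc α γ σ K σ' db dc dbc ξb ξc yb yc t : ℝ)
    (hα : 0 ≤ α) (hγ : 0 ≤ γ) (hσ : 0 ≤ σ) (hK : 0 ≤ K) (hσ'0 : 0 ≤ σ') (hσ'1 : σ' ≤ 1) (hdb : 0 ≤ db) (hdc : 0 ≤ dc)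
    (H2 : τ * σ ≤ γ + K) (H4 : σ * (α + γ) ≤ γ)
    (hRS : 0 ≤ σ' * (ξb + ξc + dbc) + db * yc + dc * yb - (3 / 2) * σ' * (mb * dc + mc * db) - 3 * σ' * db * dc)
    (ht0 : 0 ≤ t) (ht1 : t ≤ 1) :
    let δa := α * σ'
    let δb := db * σ
    let δc := dc * σ
    let δab := (γ + K) * db + α * yb
    let δac := (γ + K) * dc + α * yc
    let δbc := σ * (ξb + ξc + dbc)
    let F : ℝ → ℝ := fun x =>
      (3 / 2) * (τ * mbc + x * δabc) + (3 / 2) * ((τ + x * δa) * (mb + x * δb) * (mc + x * δc))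
        - (τ + x * δa) * (mbc + x * δbc) - (mb + x * δb) * (τ * mc + x * δac) - (mc + x * δc) * (τ * mb + x * δab)
    (1 - t) * F 0 + t * F 1 ≤ F t := by
  intro δa δb δc δab δac δbc F
  have hW := bridgeConcavityHalf_core α γ σ τ K σ' db dc dbc ξb ξc yb yc mb mc hα hγ hK hσ'0 hσ'1 hdb hdc H2 H4 hRS
  have key : F t - ((1 - t) * F 0 + t * F 1)
      = t * (1 - t) * (σ * (α * σ' * (ξb + ξc + dbc) + 2 * (γ + K) * db * dc + α * (db * yc + dc * yb)
        - (3 / 2) * τ * σ * db * dc - (9 / 2) * α * σ' * σ * db * dc - (3 / 2) * α * σ' * (mb * dc + mc * db))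
        + (3 / 2) * δa * δb * δc * (2 - t)) := by
    simp only [F, δa, δb, δc, δab, δac, δbc]
    ring
  have hddd : 0 ≤ (3 / 2) * δa * δb * δc * (2 - t) := by
    have : 0 ≤ δa * δb * δc := mul_nonneg (mul_nonneg (mul_nonneg hα hσ'0) (mul_nonneg hdb hσ)) (mul_nonneg hdc hσ)
    nlinarith
  have ht : 0 ≤ t * (1 - t) := mul_nonneg ht0 (by linarith)
  have : 0 ≤ F t - ((1 - t) * F 0 + t * F 1) := by
    rw [key]
    exact mul_nonneg ht (add_nonneg (mul_nonneg hσ hW) hddd)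
  linarith

/-- **R-side lemma, two-branch case (algebra).**  If `b` and `c` sit in different branches at the far endpoint `v` of the bridge (forest side),
then `RS = W·[½σ′(D_bH_c + D_cH_b) + ((3/2)σ′ − 1)(D_b·Cov_c + D_c·Cov_b)]` with Harris `Cov_b, Cov_c ≤ 0` and the branch lemma
`H_b + Cov_b ≥ 0`, `H_c + Cov_c ≥ 0`; this file checks that the bracket is then `≥ 0` for every `σ′ ∈ [0,1]`. [this work] -/
theorem rsideHalf_twoBranch (σ' Db Dc Hb Hc Covb Covc : ℝ) (hσ'0 : 0 ≤ σ') (hσ'1 : σ' ≤ 1)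
    (hDb : 0 ≤ Db) (hDc : 0 ≤ Dc) (hHb : 0 ≤ Hb) (hHc : 0 ≤ Hc)
    (hCovb : Covb ≤ 0) (hCovc : Covc ≤ 0) (hBrb : 0 ≤ Hb + Covb) (hBrc : 0 ≤ Hc + Covc) :
    0 ≤ (1 / 2) * σ' * (Db * Hc + Dc * Hb) + ((3 / 2) * σ' - 1) * (Db * Covc + Dc * Covb) := by
  by_cases h : (3 / 2) * σ' ≤ 1
  · -- both terms nonnegative
    have h1 : 0 ≤ (1 / 2) * σ' * (Db * Hc + Dc * Hb) := by positivity
    have h2 : 0 ≤ (1 - (3 / 2) * σ') * (-(Db * Covc + Dc * Covb)) :=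
      mul_nonneg (by linarith) (by nlinarith [mul_nonneg hDb (neg_nonneg.2 hCovc), mul_nonneg hDc (neg_nonneg.2 hCovb)])
    nlinarith [h1, h2]
  · push Not at h
    -- use |Cov| ≤ H: bracket ≥ (Db Hc + Dc Hb)(σ′/2 − (3/2)σ′ + 1) = (1 − σ′)(…) ≥ 0
    have h1 : ((3 / 2) * σ' - 1) * (Db * Covc + Dc * Covb) ≥ -(((3 / 2) * σ' - 1) * (Db * Hc + Dc * Hb)) := by
      have hpos : 0 ≤ (3 / 2) * σ' - 1 := by linarith
      have : -(Db * Hc + Dc * Hb) ≤ Db * Covc + Dc * Covb := by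
        nlinarith [mul_le_mul_of_nonneg_left (by linarith : -Hc ≤ Covc) hDb, mul_le_mul_of_nonneg_left (by linarith : -Hb ≤ Covb) hDc]
      nlinarith [mul_le_mul_of_nonneg_left this hpos]
    have h2 : 0 ≤ (1 - σ') * (Db * Hc + Dc * Hb) := by
      have : 0 ≤ Db * Hc + Dc * Hb := by positivity
      exact mul_nonneg (by linarith) this
    nlinarith [h1, h2]

/-- **R-side lemma, target-at-the-port case (algebra).**  If one of the two far targets IS the bridge endpoint `v` (`b = v`) and `c` hangs in
a branch at `v`, then `RS = W′·[½σ′H_c + ((3/2)σ′ − 1)·Cov_c]` with `Cov_c ≤ 0` (Harris) and `H_c + Cov_c ≥ 0` (branch lemma); the bracket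
is `≥ 0`. [this work] -/
theorem rsideHalf_targetAtPort (σ' Hc Covc : ℝ) (hσ'0 : 0 ≤ σ') (hσ'1 : σ' ≤ 1) (hHc : 0 ≤ Hc)
    (hCovc : Covc ≤ 0) (hBrc : 0 ≤ Hc + Covc) :
    0 ≤ (1 / 2) * σ' * Hc + ((3 / 2) * σ' - 1) * Covc := by
  by_cases h : (3 / 2) * σ' ≤ 1
  · nlinarith [mul_nonneg hσ'0 hHc, mul_nonneg (by linarith : 0 ≤ 1 - (3 / 2) * σ') (neg_nonneg.2 hCovc)]
  · push Not at h
    nlinarith [mul_le_mul_of_nonneg_left (by linarith : -Hc ≤ Covc) (by linarith : 0 ≤ (3 / 2) * σ' - 1),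
      mul_nonneg (by linarith : 0 ≤ 1 - σ') hHc]

/-- **R-side lemma, coincident far targets (algebra).**  If `b = c ≠ v`, then `RS = d·[(1 − EZ) + W′(−A + 3A·EZ − 2E[q_UZ])]` with
`W′ ∈ [0,1]`, `A, EZ ≤ 1` and `E[q_UZ] = A·EZ + Cov`, `Cov ≤ 0`; the bracket is affine in `W′` with nonnegative values at both ends. [this work] -/
theorem rsideHalf_coincident (W A EZ EqZ Cov : ℝ) (hW0 : 0 ≤ W) (hW1 : W ≤ 1) (hA1 : A ≤ 1)
    (hZ1 : EZ ≤ 1) (hEqZ : EqZ = A * EZ + Cov) (hCov : Cov ≤ 0) :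
    0 ≤ (1 - EZ) + W * (-A + 3 * A * EZ - 2 * EqZ) := by
  rw [hEqZ]
  -- value at W = 1 is (1−A)(1−EZ) − 2Cov ≥ 0, at W = 0 it is 1 − EZ ≥ 0; affine in W
  have h1 : 0 ≤ (1 - A) * (1 - EZ) - 2 * Cov := by nlinarith [mul_nonneg (sub_nonneg.2 hA1) (sub_nonneg.2 hZ1)]
  have hid : (1 - EZ) + W * (-A + 3 * A * EZ - 2 * (A * EZ + Cov)) = (1 - W) * (1 - EZ) + W * ((1 - A) * (1 - EZ) - 2 * Cov) := by ring
  rw [hid]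
  exact add_nonneg (mul_nonneg (by linarith) (by linarith)) (mul_nonneg hW0 h1)

/-- **Branch lemma, recursion step (algebra).**  For a port-tree whose first edge towards the target has weight `t` and leads to a smaller
port-tree with statistics `A₁, D₁, π₁, G₁, H₁, m₁` (`m₁ = π₁ − D₁ + G₁`; `A₁ ∈ [0,1]`, `H₁, m₁ ≥ 0`; branch lemma `D₁ + 2H₁ ≥ A₁(π₁+G₁)` assumed), the
combination `tD₁ + 2(1−t)m₁ + 2tH₁ − [(1−t)+tA₁]·[tπ₁ + (1−t)m₁ + tG₁]` (= `(D + 2H − A(π+G))/(u_w A_O)` of the bigger port-tree) is at least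
`(1−t)(2tH₁ + m₁(1 − tA₁)) ≥ 0`.  By induction over port-trees this proves the branch lemma `H + Cov(q_U, Z) ≥ 0` on every tree. [this work] -/
theorem branchLemma_step (t A1 D1 pi1 G1 H1 m1 : ℝ) (ht0 : 0 ≤ t) (ht1 : t ≤ 1) (hA0 : 0 ≤ A1) (hA1 : A1 ≤ 1)
    (hH : 0 ≤ H1) (hm0 : 0 ≤ m1) (hm : m1 = pi1 - D1 + G1)
    (hBr1 : A1 * (pi1 + G1) ≤ D1 + 2 * H1) :
    (1 - t) * (2 * t * H1 + m1 * (1 - t * A1))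
      ≤ t * D1 + 2 * (1 - t) * m1 + 2 * t * H1 - ((1 - t) + t * A1) * (t * pi1 + (1 - t) * m1 + t * G1)
    ∧ 0 ≤ (1 - t) * (2 * t * H1 + m1 * (1 - t * A1)) := by
  constructor
  · -- expand; the only inequality used is t²·A₁(π₁+G₁) ≤ t²·(D₁+2H₁)
    have h1 : t ^ 2 * (A1 * (pi1 + G1)) ≤ t ^ 2 * (D1 + 2 * H1) := mul_le_mul_of_nonneg_left hBr1 (by positivity)
    have hid : t * D1 + 2 * (1 - t) * m1 + 2 * t * H1 - ((1 - t) + t * A1) * (t * pi1 + (1 - t) * m1 + t * G1)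
        - (1 - t) * (2 * t * H1 + m1 * (1 - t * A1))
        = (t ^ 2 * (D1 + 2 * H1) - t ^ 2 * (A1 * (pi1 + G1))) + t * (1 - t) * (D1 + m1 - pi1 - G1) := by ring
    have h2 : D1 + m1 - pi1 - G1 = 0 := by rw [hm]; ring
    nlinarith [h1, hid, h2, mul_nonneg ht0 (sub_nonneg.2 ht1)]
  · have : 0 ≤ 1 - t * A1 := by nlinarith [mul_le_mul ht1 hA1 hA0 (by norm_num : (0:ℝ) ≤ 1)]
    exact mul_nonneg (by linarith) (add_nonneg (by positivity) (mul_nonneg hm0 this))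

/-! ### Appendix (lead gen 120, second landing): the algebraic skeleton of THEOREM (I2′)-tree

prim-sahi-p2's one-sided tree inequality (PROOF-E3 §28s–§28u; the last missing piece of their CONJECTURE FC — concavity of the
increasing star along EVERY pair of every apex-forest): for a forest side `R` with root pairs, a vertex `x` without root pair and targets
`b, c`, `(1−ρ)(ξ_b+ξ_c+β_bc) + (2ρ−1)β_bβ_c − β_b·Cov(A′,C′) − β_c·Cov(A′,B′) ≥ 0`.  With the two-target branch quantities
`A, D_b, D_c, D_bc, Ξ_b, Ξ_c, H_b, H_c, EZ_b, EZ_c` (memo §8) the left side equals `W²·Ψ`, `Ψ = A(Ξ_b+Ξ_c+D_bc) − D_bD_c + D_b·Cov_c + D_c·Cov_b`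
(`Cov_t = D_t + H_t − A·EZ_t ≤ 0` by Harris), and `Ψ ≥ 0` follows by an alternating port-tree / branch recursion from the branch lemma
`H_t + Cov_t ≥ 0` and the product lemma (PA) `A·D_bc ≥ D_b·D_c`.  The identities are paper-level (verified in exact arithmetic); the steps below
are the real-arithmetic parts.

* `paLemma_step` — the (PA) recursion step;
* `i2pTree_port`, `i2pTree_coincident`, `i2pTree_twoBranch` — the port-tree cases of `Ψ ≥ 0`;
* `i2pTree_branchStep` — the branch (edge-peeling) step of `Ψ ≥ 0`.
-/

/-- (PA) recursion step: prepending an edge of weight `t` to a port-tree with `A·D_bc ≥ D_b·D_c` keeps the product inequality: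
`((1−t) + tA)·(t·D_bc) − (t·D_b)(t·D_c) = t(1−t)·D_bc + t²·(A·D_bc − D_bD_c) ≥ 0`. [this work] -/
theorem paLemma_step (t A Db Dc Dbc : ℝ) (ht0 : 0 ≤ t) (ht1 : t ≤ 1) (hDbc : 0 ≤ Dbc) (hPA : Db * Dc ≤ A * Dbc) :
    (t * Db) * (t * Dc) ≤ ((1 - t) + t * A) * (t * Dbc) := by
  have hid : ((1 - t) + t * A) * (t * Dbc) - (t * Db) * (t * Dc) = t * (1 - t) * Dbc + t ^ 2 * (A * Dbc - Db * Dc) := by ring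
  nlinarith [hid, mul_nonneg (mul_nonneg ht0 (sub_nonneg.2 ht1)) hDbc, mul_nonneg (sq_nonneg t) (sub_nonneg.2 hPA)]

/-- `Ψ ≥ 0`, port case (`b` at the port: `D_b = A`, `D_bc = D_c`, `Ξ_b = H_c`, `Ξ_c = 0`, `Cov_b = 0`): `Ψ = A·(H_c + Cov_c) ≥ 0` by the branch lemma. [this work] -/
theorem i2pTree_port (A Dc Hc EZc : ℝ) (hA : 0 ≤ A) (hBr : A * EZc ≤ Dc + 2 * Hc) :
    0 ≤ A * (Hc + 0 + Dc) - A * Dc + A * (Dc + Hc - A * EZc) + Dc * 0 := by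
  have : A * (Hc + 0 + Dc) - A * Dc + A * (Dc + Hc - A * EZc) + Dc * 0 = A * (Dc + 2 * Hc - A * EZc) := by ring
  rw [this]; exact mul_nonneg hA (by linarith)

/-- `Ψ ≥ 0`, coincident far targets `b = c` (`Ξ = 0`, `D_bc = D_b = D_c = D`): `Ψ = D·(A − D + 2Cov) = D·[(D + 2H − A·EZ) + A(1 − EZ)] ≥ 0`. [this work] -/
theorem i2pTree_coincident (A D H EZ : ℝ) (hA : 0 ≤ A) (hD : 0 ≤ D) (hEZ : EZ ≤ 1) (hBr : A * EZ ≤ D + 2 * H) :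
    0 ≤ A * (0 + 0 + D) - D * D + D * (D + H - A * EZ) + D * (D + H - A * EZ) := by
  have hid : A * (0 + 0 + D) - D * D + D * (D + H - A * EZ) + D * (D + H - A * EZ)
      = D * ((D + 2 * H - A * EZ) + A * (1 - EZ)) := by ring
  rw [hid]
  exact mul_nonneg hD (add_nonneg (by linarith) (mul_nonneg hA (by linarith)))

/-- `Ψ ≥ 0`, `b` and `c` in different sub-branches `B`, `C` at the port (factor `κ = u_w·A_O`): all quantities factor and
`Ψ = κ²A_BA_C·[D_b(H_c + Cov_c) + D_c(H_b + Cov_b)] ≥ 0` by the branch lemma on each sub-branch. [this work] -/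
theorem i2pTree_twoBranch (κ AB AC Db Dc Hb Hc Covb Covc : ℝ) (hAB : 0 ≤ AB) (hAC : 0 ≤ AC)
    (hDb : 0 ≤ Db) (hDc : 0 ≤ Dc) (hBrb : 0 ≤ Hb + Covb) (hBrc : 0 ≤ Hc + Covc) :
    0 ≤ κ ^ 2 * AB * AC * (Db * (Hc + Covc) + Dc * (Hb + Covb)) := by
  have : 0 ≤ Db * (Hc + Covc) + Dc * (Hb + Covb) := add_nonneg (mul_nonneg hDb hBrc) (mul_nonneg hDc hBrb)
  positivity

/-- `Ψ ≥ 0`, branch step.  A branch = edge of weight `t` + port-tree with statistics `A, D_b, D_c, D_bc, S = Ξ_b+Ξ_c+D_bc (≥ D_bc)`,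
`P = D_bD_c + D_bH_c + D_cH_b`, `E = D_b·EZ_c + D_c·EZ_b`; exactly `Ψ_branch = t·[(1 − t(1−A))S + t(P − AE) − 2t(1−t)(1−A)D_bD_c]`.
Given `Ψ_tree = AS + P − AE ≥ 0` and (PA) `A·D_bc ≥ D_bD_c`, the bracket is `≥ (1−t)(S − 2t(1−A)D_bD_c) ≥ 0` since
`2t(1−A)D_bD_c ≤ 2A(1−A)·S ≤ S/2`. [this work] -/
theorem i2pTree_branchStep (t A Db Dc Dbc S P E : ℝ) (ht0 : 0 ≤ t) (ht1 : t ≤ 1) (hA0 : 0 ≤ A) (hA1 : A ≤ 1)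
    (hDbc : 0 ≤ Dbc) (hS : Dbc ≤ S) (hPA : Db * Dc ≤ A * Dbc) (hPsi : 0 ≤ A * S + P - A * E) :
    0 ≤ t * ((1 - t * (1 - A)) * S + t * (P - A * E) - 2 * t * (1 - t) * (1 - A) * (Db * Dc)) := by
  have hSnn : 0 ≤ S := le_trans hDbc hS
  -- key: 2t(1−A)·DbDc ≤ 2t(1−A)·A·S ≤ S/2
  have h1 : Db * Dc ≤ A * S := le_trans hPA (mul_le_mul_of_nonneg_left hS hA0)
  have h2 : 2 * t * (1 - t) * (1 - A) * (Db * Dc) ≤ (1 - t) * S := by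
    have ha : 2 * A * (1 - A) ≤ 1 / 2 := by nlinarith [sq_nonneg (2 * A - 1)]
    have h1t : 0 ≤ 1 - t := sub_nonneg.2 ht1
    have hstep : 2 * t * (1 - t) * (1 - A) * (Db * Dc) ≤ 2 * t * (1 - t) * (1 - A) * (A * S) :=
      mul_le_mul_of_nonneg_left h1 (by
        have : 0 ≤ 1 - A := sub_nonneg.2 hA1
        positivity)
    have hbound : 2 * t * (1 - t) * (1 - A) * (A * S) ≤ (1 - t) * S := by
      have : 2 * t * (1 - t) * (1 - A) * (A * S) = (1 - t) * S * (t * (2 * A * (1 - A))) := by ring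
      rw [this]
      have hin : t * (2 * A * (1 - A)) ≤ 1 := by nlinarith [ha, ht1, ht0, mul_nonneg hA0 (sub_nonneg.2 hA1)]
      have := mul_le_mul_of_nonneg_left hin (mul_nonneg h1t hSnn)
      simpa using this
    linarith
  -- assemble: bracket = (1−t)S + t(AS + P − AE) − 2t(1−t)(1−A)DbDc ≥ (1−t)S − (1−t)S·… ≥ 0
  have hbr : 0 ≤ (1 - t * (1 - A)) * S + t * (P - A * E) - 2 * t * (1 - t) * (1 - A) * (Db * Dc) := by
    have hid : (1 - t * (1 - A)) * S + t * (P - A * E) = (1 - t) * S + t * (A * S + P - A * E) := by ring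
    nlinarith [hid, h2, mul_nonneg ht0 hPsi]
  exact mul_nonneg ht0 hbr

end IncStar

end Summit.CriticalPhenomena.PercolationContinuityZ3.Theorems
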